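import Summits.CriticalPhenomena.PercolationContinuityZ3.Theorems.PercNearOneGluingNoHeavyLowerTailCertCells
import Literature.Probability.Percolation.TwoSetExchange
import HarnessLib

/-!
# `NoHeavyLowerTail` (stmt-CriticalPhenomena-4575) — certificate machine add-on: general TWO-SET EXCHANGE rows
# (vertex SETS `S, T`, compound DNF events) as checker rows

Support file (prover prim-gen-kcluster gen 5, k-cluster line; `--supports stmt-CriticalPhenomena-4575`).  Bookkeeping
definitions (`Lit.plus`, `Formula.plus`, `Formula.conj`, `sepFormula`, `vSet`, `twoSetRow`), no named facts, no sorries.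

The certificate searches of ttrl `wf3lp` (and this seat's `wf3shk`) use van den Berg–Häggström–Kahn two-SET exchange rows
(`Literature.Probability.Percolation.setTwoClusterExchange`, BHK 2006 Thm. 1.5 / 2.1 with vertex sets): for disjoint
terminal sets `S, T`, `D = {S ↮ T}`, events `A₁, A₂` generated (by `∧`, `∨`) from `{s ↔ v}`, `{t ↮ v}` (type `(+)`) and
`B₁, B₂` from `{t ↔ v}`, `{s ↮ v}` (type `(−)`):  `μ(D A₁ B₁) μ(D A₂ B₂) ≤ μ(D A₁ A₂) μ(D B₁ B₂)`.  The reflective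
checker (blobmono, `CertCells.RowSpec` / `RowSpecX`) so far replays only single-vertex `s, t` with conjunctions of
literals.  This file adds the general row as DATA on the DNF formulas of `CertCells`:
* `Lit.plus S T l` / `Formula.plus S T F` — the SYNTACTIC type test (every literal is `i ~ j` with `i` or `j` in `S`,
  or `i ≁ j` with `i` or `j` in `T`), decidable; `Formula.typePlus_of_plus` — it implies BHK's closure property
  (enlarging `C_S`, shrinking `C_T`) for the placement `v` (tree lemmas `TwoSetExchange.typePlus_*_of_mem`);
* `Formula.conj` (DNF conjunction, `set_conj`), `sepFormula S T` (`D`, `set_sepFormula`);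
* `twoSetRow_measure` — the exchange inequality for formula events; `twoSetRow` / `twoSetRow_holds` — the row
  `⟨cells(D∧A₁∧B₁), cells(D∧A₂∧B₂), cells(D∧A₁∧A₂), cells(D∧B₁∧B₂)⟩` holds (`E₁E₂ ≤ E₃E₄`) at the cell law of every
  weighted graph and placement, i.e. is admissible input of `CertCheck.sound`.
[cite: VandenbergHaggstromKahn2005, Thm. 1.5 (p. 7), Thm. 2.1 (p. 9) at q = 1]
-/

noncomputable section

namespace Summit.CriticalPhenomena.PercolationContinuityZ3.Theorems

open MeasureTheory Set Literature.Probability.Percolation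
open Literature.Probability.LatticeModels (prodBernoulli)
open scoped Classical BigOperators
open PatternCells CertCheck

namespace CertCells

variable {n : ℕ}

/-! ## Syntactic types -/

/-- A literal is of type `(+)` for `(S, T)`: `i ~ j` with `i ∈ S` or `j ∈ S`, or `i ≁ j` with `i ∈ T` or `j ∈ T`.
[folklore] -/
def Lit.plus (S T : List (Fin 5)) (l : Lit) : Bool :=
  (l.2.2 && (decide (l.1 ∈ S) || decide (l.2.1 ∈ S))) || (!l.2.2 && (decide (l.1 ∈ T) || decide (l.2.1 ∈ T)))

/-- A DNF formula is of type `(+)` for `(S, T)` if all its literals are. (Type `(−)` = type `(+)` for `(T, S)`.)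
[folklore] -/
def Formula.plus (S T : List (Fin 5)) (F : Formula) : Bool := F.all fun cl => cl.all (Lit.plus S T)

/-- Conjunction of DNF formulas (pairwise concatenation of clauses). [folklore] -/
def Formula.conj (F G : Formula) : Formula := F.flatMap fun c => G.map fun d => c ++ d

/-- The separation event `{S ↮ T}` as a one-clause formula. [folklore] -/
def sepFormula (S T : List (Fin 5)) : Formula := [S.flatMap fun i => T.map fun j => (i, j, false)]

/-- The vertex set of a list of terminal indices under the placement `v`. [folklore] -/
def vSet (v : Fin 5 → Fin n) (S : List (Fin 5)) : Set (Fin n) := {u | ∃ i ∈ S, v i = u}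

/-! ## Semantics -/

/-- Conjunction of formulas is intersection of events. [folklore] -/
theorem set_conj (v : Fin 5 → Fin n) (F G : Formula) : (F.conj G).set v = F.set v ∩ G.set v := by
  ext ω
  unfold Formula.conj Formula.set
  simp only [mem_setOf_eq, mem_inter_iff, List.mem_flatMap, List.mem_map]
  constructor
  · rintro ⟨cl, ⟨c, hc, d, hd, rfl⟩, hcl⟩
    exact ⟨⟨c, hc, fun l hl => hcl l (List.mem_append_left _ hl)⟩,
      ⟨d, hd, fun l hl => hcl l (List.mem_append_right _ hl)⟩⟩
  · rintro ⟨⟨c, hc, hcl⟩, ⟨d, hd, hdl⟩⟩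
    refine ⟨c ++ d, ⟨c, hc, d, hd, rfl⟩, fun l hl => ?_⟩
    rcases List.mem_append.1 hl with h | h
    · exact hcl l h
    · exact hdl l h

/-- The separation formula denotes `{S ↮ T}`. [folklore] -/
theorem set_sepFormula (v : Fin 5 → Fin n) (S T : List (Fin 5)) :
    (sepFormula S T).set v =
      {ω | ∀ s ∈ vSet v S, ∀ t ∈ vSet v T, ¬ (openGraph ω).Reachable s t} := by
  ext ω
  unfold sepFormula Formula.set vSet
  simp only [mem_setOf_eq, List.mem_singleton, exists_eq_left, List.mem_flatMap, List.mem_map,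
    forall_exists_index, and_imp]
  constructor
  · intro h s i hi his t j hj hjt
    subst his; subst hjt
    have := h (i, j, false) i hi j hj rfl
    unfold Lit.holds at this
    simpa using this
  · intro h l i hi j hj hl
    subst hl
    unfold Lit.holds
    simpa using h (v i) i hi rfl (v j) j hj rfl

/-- **A `(+)`-literal is closed under enlarging `C_S` and shrinking `C_T`.** [cite: VandenbergHaggstromKahn2005, Thm. 1.5] -/
theorem Lit.typePlus_of_plus (v : Fin 5 → Fin n) (S T : List (Fin 5)) {l : Lit} (hl : Lit.plus S T l = true)
    ⦃ω ω' : BondConfig (Fin n)⦄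
    (hS : (⋃ s ∈ vSet v S, openEdgeCluster ω s) ⊆ (⋃ s ∈ vSet v S, openEdgeCluster ω' s))
    (hT : (⋃ t ∈ vSet v T, openEdgeCluster ω' t) ⊆ (⋃ t ∈ vSet v T, openEdgeCluster ω t))
    (h : Lit.holds v l ω) : Lit.holds v l ω' := by
  obtain ⟨i, j, b⟩ := l
  unfold Lit.plus at hl
  unfold Lit.holds at h ⊢
  simp only [Bool.or_eq_true, Bool.and_eq_true, decide_eq_true_eq, Bool.not_eq_true'] at hl
  rcases hl with ⟨hb, hij⟩ | ⟨hb, hij⟩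
  · -- connection literal with an endpoint in `S`
    subst hb
    simp only [iff_true] at h ⊢
    rcases hij with hi | hj
    · have hmem : v i ∈ vSet v S := ⟨i, hi, rfl⟩
      have h1 : ω ∈ (openConn (v i) (v j) : Set (BondConfig (Fin n))) := h
      have h2 : ω' ∈ (openConn (v i) (v j) : Set (BondConfig (Fin n))) :=
        TwoSetExchange.typePlus_openConn_of_mem (vSet v S) (vSet v T) hmem (v j) hS hT h1
      exact h2
    · have hmem : v j ∈ vSet v S := ⟨j, hj, rfl⟩
      have h1 : ω ∈ (openConn (v j) (v i) : Set (BondConfig (Fin n))) := h.symm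
      have h2 : ω' ∈ (openConn (v j) (v i) : Set (BondConfig (Fin n))) :=
        TwoSetExchange.typePlus_openConn_of_mem (vSet v S) (vSet v T) hmem (v i) hS hT h1
      exact SimpleGraph.Reachable.symm h2
  · -- separation literal with an endpoint in `T`
    subst hb
    simp only [Bool.false_eq_true, iff_false] at h ⊢
    rcases hij with hi | hj
    · have hmem : v i ∈ vSet v T := ⟨i, hi, rfl⟩
      exact TwoSetExchange.typePlus_not_openConn_of_mem (vSet v S) (vSet v T) hmem (v j) hS hT h
    · have hmem : v j ∈ vSet v T := ⟨j, hj, rfl⟩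
      intro h'
      exact TwoSetExchange.typePlus_not_openConn_of_mem (vSet v S) (vSet v T) hmem (v i) hS hT
        (fun h'' => h (SimpleGraph.Reachable.symm h'')) h'.symm

/-- **A `(+)`-formula denotes an event of type `(+)`.** [cite: VandenbergHaggstromKahn2005, Thm. 1.5] -/
theorem Formula.typePlus_of_plus (v : Fin 5 → Fin n) (S T : List (Fin 5)) {F : Formula}
    (hF : Formula.plus S T F = true) ⦃ω ω' : BondConfig (Fin n)⦄
    (hS : (⋃ s ∈ vSet v S, openEdgeCluster ω s) ⊆ (⋃ s ∈ vSet v S, openEdgeCluster ω' s))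
    (hT : (⋃ t ∈ vSet v T, openEdgeCluster ω' t) ⊆ (⋃ t ∈ vSet v T, openEdgeCluster ω t))
    (h : ω ∈ F.set v) : ω' ∈ F.set v := by
  unfold Formula.plus at hF
  obtain ⟨cl, hcl, hall⟩ := h
  refine ⟨cl, hcl, fun l hl => ?_⟩
  have hl' : Lit.plus S T l = true := by
    have := List.all_eq_true.1 hF cl hcl
    exact List.all_eq_true.1 this l hl
  exact Lit.typePlus_of_plus v S T hl' hS hT (hall l hl)

/-! ## The row -/

/-- **Two-set exchange for formula events.**  For `A₁, A₂` of type `(+)` and `B₁, B₂` of type `(−)` (= type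
`(+)` for `(T, S)`), with `D = sepFormula S T`:
`μ((D∧A₁∧B₁)) · μ((D∧A₂∧B₂)) ≤ μ((D∧A₁∧A₂)) · μ((D∧B₁∧B₂))`. [cite: VandenbergHaggstromKahn2005, Thm. 2.1 at q = 1] -/
theorem twoSetRow_measure (w : Sym2 (Fin n) → unitInterval) (v : Fin 5 → Fin n) (S T : List (Fin 5))
    (A₁ A₂ B₁ B₂ : Formula) (hA₁ : Formula.plus S T A₁ = true) (hA₂ : Formula.plus S T A₂ = true)
    (hB₁ : Formula.plus T S B₁ = true) (hB₂ : Formula.plus T S B₂ = true) :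
    (prodBernoulli w).real (((sepFormula S T).conj (A₁.conj B₁)).set v) *
        (prodBernoulli w).real (((sepFormula S T).conj (A₂.conj B₂)).set v) ≤
      (prodBernoulli w).real (((sepFormula S T).conj (A₁.conj A₂)).set v) *
        (prodBernoulli w).real (((sepFormula S T).conj (B₁.conj B₂)).set v) := by
  simp only [set_conj, set_sepFormula]
  exact setTwoClusterExchange w (vSet v S) (vSet v T)
    (fun ω ω' hS hT h => Formula.typePlus_of_plus v S T hA₁ hS hT h)
    (fun ω ω' hS hT h => Formula.typePlus_of_plus v S T hA₂ hS hT h)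
    (fun ω ω' hS hT h => Formula.typePlus_of_plus v T S hB₁ hT hS h)
    (fun ω ω' hS hT h => Formula.typePlus_of_plus v T S hB₂ hT hS h)

/-- **The general two-set exchange row as checker data**: events as cell lists. [this file] -/
def twoSetRow (S T : List (Fin 5)) (A₁ A₂ B₁ B₂ : Formula) (mult : List ℕ) (wt : ℕ) : Row :=
  ⟨cellsOf ((sepFormula S T).conj (A₁.conj B₁)), cellsOf ((sepFormula S T).conj (A₂.conj B₂)),
    cellsOf ((sepFormula S T).conj (A₁.conj A₂)), cellsOf ((sepFormula S T).conj (B₁.conj B₂)), mult, wt⟩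

/-- **The two-set row holds at the cell law** of every weighted graph and placement (admissible input of
`CertCheck.sound`), provided the four syntactic type tests pass (decidable by `decide`).
[cite: VandenbergHaggstromKahn2005, Thm. 2.1 at q = 1] -/
theorem twoSetRow_holds (w : Sym2 (Fin n) → unitInterval) (v : Fin 5 → Fin n) (S T : List (Fin 5))
    (A₁ A₂ B₁ B₂ : Formula) (hA₁ : Formula.plus S T A₁ = true) (hA₂ : Formula.plus S T A₂ = true)
    (hB₁ : Formula.plus T S B₁ = true) (hB₂ : Formula.plus T S B₂ = true) (mult : List ℕ) (wt : ℕ) :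
    let x : ℕ → ℝ := fun m => (prodBernoulli w).real (Cell v m)
    let r := twoSetRow S T A₁ A₂ B₁ B₂ mult wt
    linEval x r.e1 * linEval x r.e2 ≤ linEval x r.e3 * linEval x r.e4 := by
  intro x r
  simp only [r, twoSetRow, x, ← measureReal_set_eq_linEval]
  exact twoSetRow_measure w v S T A₁ A₂ B₁ B₂ hA₁ hA₂ hB₁ hB₂

/-! ## A worked instance: the block tripod exchange `S = {1,2}`, `T = {3}` on terminals `0 = o`, `4 = b` -/

/-- The block tripod row `μ(D, S↔o, T↔b) μ(D, S↔b, T↔o) ≤ μ(D, S↔o, S↔b) μ(D, T↔b, T↔o)` for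
`S = {1,2}`, `T = {3}`, as an instance of `twoSetRow_measure` (type tests by `decide`).
[cite: VandenbergHaggstromKahn2005, Thm. 2.1 at q = 1] -/
theorem twoSetRow_example (w : Sym2 (Fin n) → unitInterval) (v : Fin 5 → Fin n) :
    (prodBernoulli w).real ((Formula.conj (sepFormula [1, 2] [3])
          (Formula.conj [[(1, 0, true)], [(2, 0, true)]] [[(3, 4, true)]])).set v) *
        (prodBernoulli w).real ((Formula.conj (sepFormula [1, 2] [3])
          (Formula.conj [[(1, 4, true)], [(2, 4, true)]] [[(3, 0, true)]])).set v) ≤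
      (prodBernoulli w).real ((Formula.conj (sepFormula [1, 2] [3])
          (Formula.conj [[(1, 0, true)], [(2, 0, true)]] [[(1, 4, true)], [(2, 4, true)]])).set v) *
        (prodBernoulli w).real ((Formula.conj (sepFormula [1, 2] [3])
          (Formula.conj [[(3, 4, true)]] [[(3, 0, true)]])).set v) :=
  twoSetRow_measure w v [1, 2] [3] [[(1, 0, true)], [(2, 0, true)]] [[(1, 4, true)], [(2, 4, true)]]
    [[(3, 4, true)]] [[(3, 0, true)]] (by decide) (by decide) (by decide) (by decide)

end CertCells

end Summit.CriticalPhenomena.PercolationContinuityZ3.Theorems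

end
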